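import Literature.AlgebraicGeometry.Motives.ProjClosedFractions
import Literature.AlgebraicGeometry.Motives.CartierDivisorCech
import HarnessLib

/-!
# Čech covers of a closed subscheme of `𝐏^r_A` by basic opens `Z_{H_c}` subordinate to a Cartier divisor

For `ι : Z → 𝐏^r_A` a closed immersion from an integral quasi-compact scheme and `E` a Cartier
divisor on `Z` (concrete model of `Motives/CartierDivisor`: charts `U_i` with local equations), this
file constructs a finite cover of `Z` by non-empty basic opens `Z_{H_c} = ι⁻¹ D₊(H_c)`,
`c = 0, …, M`, with ALL `H_c` homogeneous of one common degree `δ > 0` and each `Z_{H_c}` inside a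
chart of `E` (`ProjFrac.BasicCover`, `ProjFrac.exists_basicCover`): the `D₊(f)`, `f` homogeneous of
positive degree, form a basis of `𝐏` (Mathlib `ProjectiveSpectrum.isTopologicalBasis_basic_opens`
with `basicOpen_eq_union_of_projection`), a closed immersion is an embedding, `Z` is compact, and
degrees are equalised by `D₊(f^k) = D₊(f)`. Packaged with the structure morphism `pr : Z → B` this
is a `CartierDivisor.CechCover pr ⊤ E` (`BasicCover.toCechCover`; the `Z_{H_c}` are affine because
`ι` is affine), whose ordered Čech complex `Č(𝔚, 𝒪_Z(E))` (`Motives/CartierDivisorCech`) is the one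
compared with the algebraic Čech complex of a graded module in the sequel (Serre's finiteness
theorem for line bundles on `Z`, Hartshorne III Thm. 5.2).

Everything is proved; no named facts.

## References

* R. Hartshorne, *Algebraic Geometry*, GTM 52 (1977): II Prop. 2.5, III Thm. 5.2 (proof: cover by
  the `D₊(x_i)`; here refined to basic opens trivialising the line bundle). [Hartshorne1977]
* U. Görtz, T. Wedhorn, *Algebraic Geometry II* (2023), Def. 21.68 (ordered Čech complex).
  [GortzWedhorn2023]
-/

noncomputable section

open CategoryTheory AlgebraicGeometry TopologicalSpace Opposite HomogeneousLocalization
open Literature.Algebra.Homology.LaurentCech Literature.AlgebraicGeometry.Morphisms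
open Literature.AlgebraicGeometry.Morphisms.ProjCech
open Literature.AlgebraicGeometry.Motives.RatFn

universe u

attribute [local instance] MvPolynomial.gradedAlgebra

namespace Literature.AlgebraicGeometry.Motives

namespace ProjFrac

variable {A : Type u} [CommRing A] {r : ℕ} {Z : Scheme.{u}} (ι : Z ⟶ PP A r) [IsIntegral Z]
  (E : CartierDivisor Z)

/-- **A cover of `Z` by non-empty basic opens `Z_{H_c}`, `c = 0, …, M`, with all `H_c` homogeneous
of the same degree `δ > 0`, subordinate to the charts of the Cartier divisor `E`.** [folklore] -/
structure BasicCover where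
  /-- `H_0, …, H_M`. -/
  M : ℕ
  /-- The common degree. -/
  δ : ℕ
  δ_pos : 0 < δ
  /-- The homogeneous polynomials. -/
  H : Fin (M + 1) → MvPolynomial (Fin (r + 1)) A
  H_mem : ∀ c, H c ∈ grading A r δ
  /-- The `Z_{H_c}` are non-empty. -/
  genericPoint_mem : ∀ c, genericPoint Z ∈ ZH ι (H c)
  /-- A chart of `E` containing `Z_{H_c}`. -/
  chart : Fin (M + 1) → E.ι
  ZH_le : ∀ c, ZH ι (H c) ≤ E.U (chart c)
  /-- The `Z_{H_c}` cover `Z`. -/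
  iSup_ZH : ⨆ c, ZH ι (H c) = ⊤

omit [IsIntegral Z] in
/-- **Basic opens `ι⁻¹D₊(f)`, `f` homogeneous of positive degree, form a basis of `Z`** for `ι` an
embedding (e.g. a closed immersion): every neighbourhood of a point contains one. [folklore] -/
theorem exists_ZH_subset [IsClosedImmersion ι] {U : Z.Opens} {z : Z} (hz : z ∈ U) :
    ∃ (d : ℕ) (f : MvPolynomial (Fin (r + 1)) A), f ∈ grading A r d ∧ 0 < d ∧
      z ∈ ZH ι f ∧ ZH ι f ≤ U := by
  classical
  -- `U = ι⁻¹ V`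
  obtain ⟨V, hV, hVU⟩ := ι.isClosedEmbedding.isInducing.isOpen_iff.1 U.isOpen
  have hzV : ι z ∈ V := by
    change z ∈ ι.base ⁻¹' V
    rw [hVU]; exact hz
  -- a basic open `D₊(g) ∋ ι z` inside `V`
  obtain ⟨_, ⟨g, rfl⟩, hzg, hgV⟩ :=
    (ProjectiveSpectrum.isTopologicalBasis_basic_opens (grading A r)).exists_subset_of_mem_open hzV hV
  -- a homogeneous component `g_i` with `ι z ∈ D₊(g_i)`
  have hzg' : ι z ∈ ⨆ i : ℕ, ProjectiveSpectrum.basicOpen (grading A r)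
      (GradedRing.proj (grading A r) i g) := by
    rw [← ProjectiveSpectrum.basicOpen_eq_union_of_projection]
    exact (show ι z ∈ (ProjectiveSpectrum.basicOpen (grading A r) g :
      Set (ProjectiveSpectrum (grading A r))) from hzg)
  obtain ⟨i, hi⟩ := Opens.mem_iSup.1 hzg'
  -- and a coordinate `x_j` with `ι z ∈ D₊(x_j)`
  obtain ⟨j, hj⟩ : ∃ j : Fin (r + 1), ι z ∈ Proj.basicOpen (grading A r) (MvPolynomial.X j) :=
    Opens.mem_iSup.1 (by
      rw [Proj.iSup_basicOpen_eq_top (grading A r) (fun j : Fin (r + 1) => MvPolynomial.X (R := A) j)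
        (Segre.irrelevant_le_span_X (Fin (r + 1)) A)]
      exact Opens.mem_top _)
  refine ⟨i + 1, GradedRing.proj (grading A r) i g * MvPolynomial.X j,
    SetLike.mul_mem_graded (by
      rw [GradedRing.proj_apply]; exact SetLike.coe_mem _) (ProjectiveSpace.X_mem j), Nat.succ_pos i, ?_, ?_⟩
  · change ι z ∈ Proj.basicOpen (grading A r) _
    rw [Proj.basicOpen_mul]
    exact ⟨hi, hj⟩
  · intro y hy
    have hy' : ι y ∈ Proj.basicOpen (grading A r) (GradedRing.proj (grading A r) i g) :=
      (Proj.basicOpen_mono _ _ _ ⟨MvPolynomial.X j, rfl⟩) hy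
    have hyg : ι y ∈ (ProjectiveSpectrum.basicOpen (grading A r) g :
        Set (ProjectiveSpectrum (grading A r))) := by
      rw [ProjectiveSpectrum.basicOpen_eq_union_of_projection (grading A r) g]
      exact Opens.mem_iSup.2 ⟨i, hy'⟩
    have : y ∈ ι.base ⁻¹' V := hgV hyg
    rwa [hVU] at this

/-- **Existence of a basic cover subordinate to `E`** for `ι` a closed immersion and `Z` integral and
quasi-compact. [folklore] -/
theorem exists_basicCover [IsClosedImmersion ι] [CompactSpace Z] : Nonempty (BasicCover ι E) := by
  classical
  -- pointwise choices
  choose iE hiE using E.covers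
  choose d f hf hd hzf hfU using fun z : Z => exists_ZH_subset ι (U := E.U (iE z)) (hiE z)
  -- a finite subcover
  obtain ⟨t, ht⟩ := isCompact_univ.elim_finite_subcover (fun z : Z => (ZH ι (f z) : Set Z))
    (fun z => (ZH ι (f z)).isOpen) (fun z _ => Set.mem_iUnion.2 ⟨z, hzf z⟩)
  have htne : t.Nonempty := by
    obtain ⟨z⟩ := (inferInstance : Nonempty Z)
    obtain ⟨z', hz', _⟩ := Set.mem_iUnion₂.1 (ht (Set.mem_univ z))
    exact ⟨z', hz'⟩
  -- index by `Fin (M + 1)`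
  obtain ⟨M, hM⟩ : ∃ M, t.card = M + 1 := Nat.exists_eq_succ_of_ne_zero (Finset.card_pos.2 htne).ne'
  let eqv : Fin (M + 1) ≃ t := (t.equivFin.trans (finCongr hM)).symm
  -- common degree `δ = ∏ d` and exponents `k_c = δ / d_c`
  let δ : ℕ := ∏ z ∈ t, d z
  have hδ : 0 < δ := Finset.prod_pos fun z _ => hd z
  have hdvd : ∀ c : Fin (M + 1), d (eqv c) ∣ δ := fun c => Finset.dvd_prod_of_mem _ (eqv c).2
  refine ⟨{
    M := M
    δ := δ
    δ_pos := hδ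
    H := fun c => f (eqv c) ^ (δ / d (eqv c))
    H_mem := fun c => ?_
    genericPoint_mem := fun c => ?_
    chart := fun c => iE (eqv c)
    ZH_le := fun c => ?_
    iSup_ZH := ?_ }⟩
  · have := SetLike.pow_mem_graded (δ / d (eqv c)) (hf (eqv c))
    rwa [smul_eq_mul, Nat.div_mul_cancel (hdvd c)] at this
  · have hk : 0 < δ / d (eqv c) := Nat.div_pos (Nat.le_of_dvd hδ (hdvd c)) (hd _)
    rw [ZH_pow ι _ hk]
    exact genericPoint_mem_of_mem (hzf (eqv c))
  · have hk : 0 < δ / d (eqv c) := Nat.div_pos (Nat.le_of_dvd hδ (hdvd c)) (hd _)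
    rw [ZH_pow ι _ hk]
    exact hfU (eqv c)
  · apply top_unique
    intro z _
    obtain ⟨z', hz', hzz'⟩ := Set.mem_iUnion₂.1 (ht (Set.mem_univ z))
    have hk : 0 < δ / d z' := Nat.div_pos (Nat.le_of_dvd hδ (Finset.dvd_prod_of_mem _ hz')) (hd _)
    rw [Opens.mem_iSup]
    refine ⟨eqv.symm ⟨z', hz'⟩, ?_⟩
    simp only [Equiv.apply_symm_apply]
    rw [ZH_pow ι _ hk]
    exact hzz'

namespace BasicCover

variable {ι E} (𝒞 : BasicCover ι E) {B : Scheme.{u}} (pr : Z ⟶ B)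

/-- **The Čech cover of `(pr, ⊤, E)` by the `Z_{H_c}`** (affine as `ι` is affine). [folklore] -/
def toCechCover [IsAffineHom ι] : CartierDivisor.CechCover pr ⊤ E where
  r := 𝒞.M
  W := fun c => ZH ι (𝒞.H c)
  W_le := fun _ => by rw [Scheme.Hom.preimage_top]; exact le_top
  isAffineOpen_W := fun c => isAffineOpen_ZH ι (𝒞.H_mem c) 𝒞.δ_pos
  genericPoint_mem_W := 𝒞.genericPoint_mem
  chart := 𝒞.chart
  W_le_U := 𝒞.ZH_le
  iSup_W := by rw [𝒞.iSup_ZH, Scheme.Hom.preimage_top]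

/-- The opens of the Čech cover are the `Z_{H_c}`. [folklore] -/
@[simp] theorem toCechCover_W [IsAffineHom ι] (c : Fin (𝒞.M + 1)) :
    (𝒞.toCechCover pr).W c = ZH ι (𝒞.H c) := rfl

/-- The number of members. [folklore] -/
@[simp] theorem toCechCover_r [IsAffineHom ι] : (𝒞.toCechCover pr).r = 𝒞.M := rfl

/-- The product `H_s = ∏_{c ∈ s} H_c`, homogeneous of degree `#s · δ`. [folklore] -/
def Hs (s : Finset (Fin (𝒞.M + 1))) : MvPolynomial (Fin (r + 1)) A := ∏ c ∈ s, 𝒞.H c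

/-- `H_s` is homogeneous of degree `#s · δ`. [folklore] -/
theorem Hs_mem (s : Finset (Fin (𝒞.M + 1))) : 𝒞.Hs s ∈ grading A r (s.card * 𝒞.δ) := by
  classical
  rw [Hs]
  induction s using Finset.induction_on with
  | empty => simpa using SetLike.one_mem_graded (grading A r)
  | insert c s hc ih =>
    rw [Finset.prod_insert hc, Finset.card_insert_of_notMem hc, add_mul, one_mul,
      Nat.add_comm (s.card * 𝒞.δ) 𝒞.δ]
    exact SetLike.mul_mem_graded (𝒞.H_mem c) ih

/-- `Z_{H_s} = ⋂_{c ∈ s} Z_{H_c}`. [folklore] -/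
theorem ZH_Hs_eq_inf (s : Finset (Fin (𝒞.M + 1))) :
    ZH ι (𝒞.Hs s) = s.inf fun c => ZH ι (𝒞.H c) := by
  classical
  rw [Hs]
  induction s using Finset.induction_on with
  | empty => simp [ZH, Proj.basicOpen_one]
  | insert c s hc ih =>
    rw [Finset.inf_insert, Finset.prod_insert hc, ZH_mul, ih]

/-- The generic point lies in every `Z_{H_s}`. [folklore] -/
theorem genericPoint_mem_ZH_Hs (s : Finset (Fin (𝒞.M + 1))) : genericPoint Z ∈ ZH ι (𝒞.Hs s) := by
  classical
  rw [Hs]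
  induction s using Finset.induction_on with
  | empty =>
    simp only [Finset.prod_empty, ZH, Proj.basicOpen_one, Scheme.Hom.preimage_top]
    exact Opens.mem_top _
  | insert c s hc ih =>
    rw [Finset.prod_insert hc, ZH_mul]
    exact ⟨𝒞.genericPoint_mem c, ih⟩

/-- **`Z_{H_s} = ⋂_{c ∈ s} Z_{H_c}` is the open `W_s` of the Čech cover.** [folklore] -/
theorem opens_toCechCover [IsAffineHom ι] (s : Finset (Fin (𝒞.M + 1))) :
    (𝒞.toCechCover pr).opens s = ZH ι (𝒞.Hs s) := by
  rw [CartierDivisor.CechCover.opens, Scheme.Hom.preimage_top, top_inf_eq, ZH_Hs_eq_inf]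
  rfl

end BasicCover

end ProjFrac

end Literature.AlgebraicGeometry.Motives

end
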